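import Literature.AlgebraicGeometry.Frobenioids.PadicKummerRemark221Tri
import HarnessLib

/-!
# Frobenioids II, Remark 2.2.1 WITHOUT `Gal(K̄/L) ≤ H`: the norm step, and the root for `N` coprime to
# `[Gal(K̄/L) : H ∩ Gal(K̄/L)]`

Mochizuki, *The geometry of Frobenioids II*, Kyushu J. Math. **62** (2008) 401–460, §2, Remark 2.2.1
p. 18 [cite: MochizukiFrdII2008, Rmk 2.2.1 p.18]: "any element `f ∈ O^□(A)^H` admits an `N`-th root
`g ∈ O^□(A)` — i.e., `g^N = f`."

PROOF-ONLY companion of `PadicKummerRemark221.lean` / `PadicKummerRemark221Tri.lean` (abc-iut-L1-t7),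
abc-iut cell, D-0079 L-F [FrdI/II], GAP-2 on FACT-LIST row F-1198 `SaturatedInvariantsAdmitRoots`
(routed by abc-iut-L1-lead; desk route of abc-iut-L1-d9). abc-iut-L1-t7 proved the named fact at the
arithmetic context `Def22Context.ofLocalField L H hH S` under the EXTRA hypothesis `hHL : Gal(K̄/L) ≤ H`
(then `Ker(H ↠ H_A) = Gal(K̄/L)` and the `N`-th root `α` of `f`, fixed by that kernel by condition (c) of
Def. 2.2 (ii), lies in `L`). This file removes part of that hypothesis:

* `exists_pow_relIndex_mem_range_pow_of_isNHSaturated` — the NORM STEP, with NO hypothesis on `H`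
  beyond (N, H)-saturation: for `f ∈ O^□(A)^H` there is `β ∈ L` with `β^N = f^m`,
  `m = [Gal(K̄/L) : H ∩ Gal(K̄/L)] = H.relIndex (galFixing K L)` (`= [L·K̄^H : L]`). Proof: condition
  (c) gives an `N`-th root `α ∈ K̄` of `f` fixed by `H ∩ Gal(K̄/L)` (t7's `smul_eq_of_isNHSaturated`);
  `β := ∏_{c ∈ Gal(K̄/L)/(H ∩ Gal(K̄/L))} c·α` is fixed by `Gal(K̄/L)`, hence in `L`, and
  `β^N = ∏ c·f = f^m`.
* `saturatedInvariantsAdmitRoots_ofLocalField_of_coprime` — **Remark 2.2.1 DISCHARGED whenever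
  `gcd(N, m) = 1`** (in particular whenever `gcd(N, (Γ_K : H)) = 1`, `…_of_coprime_index`, since
  `m ∣ (Γ_K : H)` for `H` normal): Bézout `aN + bm = 1` gives the root `g = f^a β^b ∈ L`, in `O^□_L` by
  root-closure. The case `Gal(K̄/L) ≤ H` of t7 (p409473) is `m = 1` (not restated here).
* the `O^□_L` forms of Definition 2.2 (iii) at a field with a valuative structure / a non-archimedean
  local field (`…_box_of_coprime_index`, `…'_of_coprime_index` — the GAP-2 signature plus ONE
  hypothesis `Nat.Coprime N H.index`).

HONEST SCOPE. The general case (no coprimality) needs the counting argument of abc-iut-L1-d9's desk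
route: with `M := K̄^H`, `E := L ∩ M`, condition (c) gives `|M^×/M^{×N}| = |(E^× ∩ L^{×N})/E^{×N}|`,
and the local unit-index inequality `|E^×/E^{×N}| ≤ |M^×/M^{×N}|` ([Neukirch ANT] II (5.8), [Serre,
Corps locaux] XIV) then forces `E^× ⊆ L^{×N}`; that inequality (structure of the unit group of a
`p`-adic field for `p ∣ N`) is NOT in the tree and is recorded as the residual GAP, not assumed here.
Nothing here concerns [IUTchIII]; no side taken. Universe `0` (as the parents).
-/

noncomputable section

namespace Literature.AlgebraicGeometry.Frobenioids

namespace PadicKummer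

namespace Def22Context

open Field IntermediateField
open scoped ValuativeRel
open Literature.NumberTheory.GaloisRepresentations
open Literature.NumberTheory.GaloisRepresentations.LocalWeilDatum

section NormStep

variable {K : Type} [Field K] [CharZero K] (L : IntermediateField K (AlgebraicClosure K))
  [Normal K L] [FiniteDimensional K L]
  (H : Subgroup (absoluteGaloisGroup K)) [H.Normal] (hH : IsOpen (H : Set (absoluteGaloisGroup K)))
  (S : StableSubmonoid L) (N : ℕ) [NeZero N]

omit [CharZero K] [Normal K L] [FiniteDimensional K L] [H.Normal] [NeZero N] in
/-- Elements of `Gal(K̄/L)` fix the image of `L` in `K̄`. [folklore] -/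
private theorem smul_coe_eq_of_mem_galFixing {σ : absoluteGaloisGroup K} (hσ : σ ∈ galFixing K L)
    (y : L) : σ • ((y : L) : AlgebraicClosure K) = y :=
  (mem_galFixing_iff (F := K)).1 hσ _ y.2

omit [Normal K L] [FiniteDimensional K L] in
include hH in
/-- `[Gal(K̄/L) : H ∩ Gal(K̄/L)]` is finite and positive: `H` is open, so of finite index in the compact
group `Γ_K`, and `H.relIndex Gal(K̄/L) ∣ (Γ_K : H)` (`H` normal). [folklore] -/
private theorem relIndex_galFixing_ne_zero : H.relIndex (galFixing K L) ≠ 0 := by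
  haveI : Finite (absoluteGaloisGroup K ⧸ H) := Subgroup.quotient_finite_of_isOpen H hH
  intro h0
  have hdvd := Subgroup.relIndex_dvd_index_of_normal H (galFixing K L)
  rw [h0, zero_dvd_iff] at hdvd
  exact Subgroup.index_ne_zero_of_finite hdvd

/-- **Remark 2.2.1, the NORM STEP (no hypothesis on `H` beyond saturation).** For `K` of
characteristic `0`, `L ⊆ K̄` finite Galois, `H ⊴ Γ_K` open, `O^□_L` containing the `N`-th roots of unity
of `L`, and `A = ofLocalField L H hH S` `(N, H)`-saturated: every `f ∈ O^□(A)^H` satisfies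
`f^m = β^N` for some `β ∈ L`, where `m = [Gal(K̄/L) : H ∩ Gal(K̄/L)]`. (Condition (c) ⇒ an `N`-th root
`α ∈ K̄` of `f` is fixed by `H ∩ Gal(K̄/L)`; `β` = the product of the `Gal(K̄/L)/(H ∩ Gal(K̄/L))`-conjugates
of `α`.) [cite: MochizukiFrdII2008, Rmk 2.2.1 p.18] -/
theorem exists_pow_eq_pow_relIndex_of_isNHSaturated
    (hS1 : ∀ x : L, x ^ N = 1 → x ∈ S.toSubmonoid)
    (hsat : IsNHSaturated (ofLocalField L H hH S) N) {f : GalMonoid S}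
    (hf : f ∈ Kummer.invariantsSubmonoid (GalMonoid S) (ofLocalField L H hH S).HA) :
    ∃ β : L, β ^ N = f.val ^ H.relIndex (galFixing K L) := by
  have hN : 0 < N := NeZero.pos N
  -- (a) `μ_N`-saturation ⇒ `μ_N(K̄) ⊆ L`
  have hμ := coe_rootsOfUnity_mem_of_isMuSaturated L S N hsat.muSaturated
  -- an `N`-th root `α` of `f` in `K̄`
  set x : AlgebraicClosure K := ((f.val : L) : AlgebraicClosure K) with hx
  have hf0 : x ≠ 0 := by
    rw [hx, Ne, ZeroMemClass.coe_eq_zero]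
    exact GalMonoid.val_ne_zero f
  obtain ⟨α, hαN⟩ := IsAlgClosed.exists_pow_nat_eq x hN
  have hα0 : α ≠ 0 := fun h => hf0 (by rw [← hαN, h, zero_pow hN.ne'])
  let αu : (AlgebraicClosure K)ˣ := Units.mk0 α hα0
  have hαu : ∀ σ : absoluteGaloisGroup K, σ ∈ H → σ • αu ^ N = αu ^ N := fun σ hσ => by
    apply Units.ext
    rw [Units.coe_smul, Units.val_pow_eq_pow_val, Units.val_mk0, hαN]
    exact smul_coe_eq_of_mem_invariants L H hH S hf hσ
  -- (c) ⇒ `α` is fixed by `H ∩ Gal(K̄/L)`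
  have hfix : ∀ σ : absoluteGaloisGroup K, σ ∈ H → σ ∈ galFixing K L → σ • α = α :=
    fun σ hσH hσL => by
    have h := smul_eq_of_isNHSaturated L H hH (GalMonoid S) (MonoidHom.id _) (fun _ _ => rfl)
      (muModelOfSubmonoid L S N hS1 hN hμ) hsat αu hαu σ hσH
      (by rw [← MonoidHom.mem_ker, ker_resGal]; exact hσL)
    have h' := congrArg (fun u : (AlgebraicClosure K)ˣ => (u : AlgebraicClosure K)) h
    simpa only [Units.coe_smul, αu, Units.val_mk0] using h'
  -- the finite quotient `Q = Gal(K̄/L) / (H ∩ Gal(K̄/L))`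
  haveI : (H.subgroupOf (galFixing K L)).FiniteIndex := ⟨relIndex_galFixing_ne_zero L H hH⟩
  haveI : Fintype (galFixing K L ⧸ H.subgroupOf (galFixing K L)) := Fintype.ofFinite _
  -- representatives act on `α` independently of the choice
  have hrep : ∀ (τ : galFixing K L) (c : galFixing K L ⧸ H.subgroupOf (galFixing K L)),
      ((τ * Quotient.out c : galFixing K L) : absoluteGaloisGroup K) • α =
        ((Quotient.out (τ • c) : galFixing K L) : absoluteGaloisGroup K) • α := by
    intro τ c
    have hcos : ((Quotient.out (τ • c) : galFixing K L) : galFixing K L ⧸ H.subgroupOf (galFixing K L)) =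
        ((τ * Quotient.out c : galFixing K L) : galFixing K L ⧸ H.subgroupOf (galFixing K L)) := by
      rw [QuotientGroup.out_eq']
      conv_lhs => rw [← QuotientGroup.out_eq' c]
      rw [MulAction.Quotient.smul_coe, smul_eq_mul]
    have hmem : (((Quotient.out (τ • c))⁻¹ * (τ * Quotient.out c) : galFixing K L) :
        absoluteGaloisGroup K) ∈ H := Subgroup.mem_subgroupOf.mp (QuotientGroup.eq.mp hcos)
    have hmemL : (((Quotient.out (τ • c))⁻¹ * (τ * Quotient.out c) : galFixing K L) :
        absoluteGaloisGroup K) ∈ galFixing K L := SetLike.coe_mem _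
    have hη := hfix _ hmem hmemL
    -- `η • α = α` with `η = out(τc)⁻¹ · (τ · out c)`; multiply by `out(τc)`
    have h2 := congrArg (fun z => ((Quotient.out (τ • c) : galFixing K L) : absoluteGaloisGroup K) • z) hη
    rw [← mul_smul, Subgroup.coe_mul, Subgroup.coe_inv, ← mul_assoc, mul_inv_cancel, one_mul,
      Subgroup.coe_mul] at h2
    rw [Subgroup.coe_mul]
    exact h2
  -- `β' := ∏_c (out c) • α` is fixed by `Gal(K̄/L)`
  set β' : AlgebraicClosure K := ∏ c : galFixing K L ⧸ H.subgroupOf (galFixing K L),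
    ((Quotient.out c : galFixing K L) : absoluteGaloisGroup K) • α with hβ'
  have hβ'fix : ∀ σ : absoluteGaloisGroup K, σ ∈ galFixing K L → σ • β' = β' := by
    intro σ hσ
    have hστ : σ = ((⟨σ, hσ⟩ : galFixing K L) : absoluteGaloisGroup K) := rfl
    rw [hβ', hστ, ← MulSemiringAction.toRingHom_apply, map_prod]
    simp only [MulSemiringAction.toRingHom_apply]
    calc ∏ c : galFixing K L ⧸ H.subgroupOf (galFixing K L), ((⟨σ, hσ⟩ : galFixing K L) : absoluteGaloisGroup K) •
            (((Quotient.out c : galFixing K L) : absoluteGaloisGroup K) • α)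
        = ∏ c : galFixing K L ⧸ H.subgroupOf (galFixing K L),
            ((Quotient.out ((⟨σ, hσ⟩ : galFixing K L) • c) : galFixing K L) : absoluteGaloisGroup K) • α :=
          Finset.prod_congr rfl fun c _ => by rw [← mul_smul, ← Subgroup.coe_mul, hrep]
      _ = ∏ c : galFixing K L ⧸ H.subgroupOf (galFixing K L),
            ((Quotient.out c : galFixing K L) : absoluteGaloisGroup K) • α :=
          Equiv.prod_comp (MulAction.toPerm ((⟨σ, hσ⟩ : galFixing K L)))
            (fun c : galFixing K L ⧸ H.subgroupOf (galFixing K L) =>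
              ((Quotient.out c : galFixing K L) : absoluteGaloisGroup K) • α)
  have hβ'L : β' ∈ L := mem_of_forall_galFixing_smul_eq L hβ'fix
  -- `β'^N = ∏_c (out c) • f = f^m`
  have hβ'N : β' ^ N = x ^ H.relIndex (galFixing K L) := by
    rw [hβ', ← Finset.prod_pow]
    have hterm : ∀ c : galFixing K L ⧸ H.subgroupOf (galFixing K L),
        (((Quotient.out c : galFixing K L) : absoluteGaloisGroup K) • α) ^ N = x := fun c => by
      rw [← smul_pow', hαN]
      exact smul_coe_eq_of_mem_galFixing L (SetLike.coe_mem (Quotient.out c)) f.val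
    simp only [hterm]
    rw [Finset.prod_const, Finset.card_univ]
    congr 1
    rw [Subgroup.relIndex, Subgroup.index, Nat.card_eq_fintype_card]
  refine ⟨⟨β', hβ'L⟩, Subtype.ext ?_⟩
  rw [SubmonoidClass.coe_pow, SubmonoidClass.coe_pow]
  exact hβ'N

end NormStep

section Coprime

variable {K : Type} [Field K] [CharZero K] (L : IntermediateField K (AlgebraicClosure K))
  [Normal K L] [FiniteDimensional K L]
  (H : Subgroup (absoluteGaloisGroup K)) [H.Normal] (hH : IsOpen (H : Set (absoluteGaloisGroup K)))
  (S : StableSubmonoid L) (N : ℕ) [NeZero N]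

/-- **Remark 2.2.1 DISCHARGED for `N` coprime to `[Gal(K̄/L) : H ∩ Gal(K̄/L)]`** (no `Gal(K̄/L) ≤ H`):
for `K` of characteristic `0`, `L ⊆ K̄` finite Galois, `H ⊴ Γ_K` open, `O^□_L` closed under `N`-th
roots in `L`, the named fact `SaturatedInvariantsAdmitRoots` holds for `ofLocalField L H hH S`:
Bézout `aN + bm = 1` with the norm step `β^N = f^m` gives the root `g = f^a β^b ∈ O^□_L`.
[cite: MochizukiFrdII2008, Rmk 2.2.1 p.18] -/
theorem saturatedInvariantsAdmitRoots_ofLocalField_of_coprime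
    (hS : ∀ x : L, x ^ N ∈ S.toSubmonoid → x ∈ S.toSubmonoid)
    (hcop : Nat.Coprime N (H.relIndex (galFixing K L))) :
    SaturatedInvariantsAdmitRoots (ofLocalField L H hH S) N := by
  intro hsat f hf
  have hS1 : ∀ x : L, x ^ N = 1 → x ∈ S.toSubmonoid := fun x hx =>
    hS x (by rw [hx]; exact S.toSubmonoid.one_mem)
  obtain ⟨β, hβ⟩ := exists_pow_eq_pow_relIndex_of_isNHSaturated L H hH S N hS1 hsat hf
  set m : ℕ := H.relIndex (galFixing K L) with hm
  -- Bézout over `ℤ`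
  obtain ⟨a, b, hab⟩ : ∃ a b : ℤ, a * (N : ℤ) + b * (m : ℤ) = 1 := Nat.isCoprime_iff_coprime.mpr hcop
  have hf0 : (f.val : L) ≠ 0 := GalMonoid.val_ne_zero f
  have hβ0 : β ≠ 0 := by
    intro h
    rw [h, zero_pow (NeZero.ne N)] at hβ
    exact pow_ne_zero _ hf0 hβ.symm
  -- the root `g := f^a · β^b`
  set g : L := f.val ^ a * β ^ b with hg
  have hgN : g ^ N = f.val := by
    have h1 : (f.val ^ a) ^ N = f.val ^ (a * (N : ℤ)) := by
      rw [← zpow_natCast (f.val ^ a) N, ← zpow_mul]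
    have h2 : (β ^ b) ^ N = f.val ^ (b * (m : ℤ)) := by
      rw [← zpow_natCast (β ^ b) N, ← zpow_mul, mul_comm b, zpow_mul, zpow_natCast, hβ,
        ← zpow_natCast (f.val) m, ← zpow_mul, mul_comm]
    rw [hg, mul_pow, h1, h2, ← zpow_add₀ hf0, hab, zpow_one]
  have hgS : g ∈ S.toSubmonoid := hS g (by rw [hgN]; exact f.val_mem)
  refine ⟨GalMonoid.mk g hgS, GalMonoid.ext ?_⟩
  rw [GalMonoid.val_pow, GalMonoid.val_mk, hgN]

/-- **… in particular for `N` coprime to `(Γ_K : H)`** (`[Gal(K̄/L) : H ∩ Gal(K̄/L)]` divides the index of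
the normal subgroup `H`). [cite: MochizukiFrdII2008, Rmk 2.2.1 p.18] -/
theorem saturatedInvariantsAdmitRoots_ofLocalField_of_coprime_index
    (hS : ∀ x : L, x ^ N ∈ S.toSubmonoid → x ∈ S.toSubmonoid) (hcop : Nat.Coprime N H.index) :
    SaturatedInvariantsAdmitRoots (ofLocalField L H hH S) N :=
  saturatedInvariantsAdmitRoots_ofLocalField_of_coprime L H hH S N hS
    (hcop.coprime_dvd_right (Subgroup.relIndex_dvd_index_of_normal H (galFixing K L)))

end Coprime

section Box

variable (K : Type) [Field K] [ValuativeRel K] [CharZero K] (L : IntermediateField K (AlgebraicClosure K))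
  [Normal K L] [FiniteDimensional K L]
  (H : Subgroup (absoluteGaloisGroup K)) [H.Normal] (hH : IsOpen (H : Set (absoluteGaloisGroup K)))
  (fs : Prop) (N : ℕ) [NeZero N]

/-- **Remark 2.2.1 for `O^□_L` of Definition 2.2 (iii)** (either case of «fieldwise saturated»),
WITHOUT `Gal(K̄/L) ≤ H`, for `N` coprime to `(Γ_K : H)` — root-closure of `O^□_L` is
abc-iut-L1-t7's `mem_boxStableSubmonoid_of_pow_mem`. [cite: MochizukiFrdII2008, Rmk 2.2.1 p.18] -/
theorem saturatedInvariantsAdmitRoots_ofLocalField_box_of_coprime_index (hcop : Nat.Coprime N H.index) :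
    SaturatedInvariantsAdmitRoots (ofLocalField L H hH (boxStableSubmonoid K L fs)) N :=
  saturatedInvariantsAdmitRoots_ofLocalField_of_coprime_index L H hH (boxStableSubmonoid K L fs) N
    (fun _ hx => mem_boxStableSubmonoid_of_pow_mem K L N fs (NeZero.pos N) hx) hcop

end Box

section LocalField

/-- **GAP-2 (FACT-LIST F-1198) at a non-archimedean local field of characteristic `0`, the sharpest
instance proved here**: the signature asked by abc-iut-L1-d9 / abc-iut-L1-lead, plus the ONE hypothesis
`Nat.Coprime N H.index`. The residual case (`gcd(N, (Γ_K : H)) > 1`) is the local unit-index count of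
the module docstring — open, not assumed. [cite: MochizukiFrdII2008, Rmk 2.2.1 p.18] -/
theorem saturatedInvariantsAdmitRoots_ofLocalField'_of_coprime_index (K : Type) [Field K] [ValuativeRel K]
    [TopologicalSpace K] [IsNonarchimedeanLocalField K] [CharZero K]
    (L : IntermediateField K (AlgebraicClosure K)) [FiniteDimensional K L] [Normal K L]
    (H : Subgroup (absoluteGaloisGroup K)) [H.Normal] (hH : IsOpen (H : Set (absoluteGaloisGroup K)))
    (fs : Prop) (N : ℕ) [NeZero N] (hcop : Nat.Coprime N H.index) :
    PadicKummer.SaturatedInvariantsAdmitRoots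
      (Def22Context.ofLocalField L H hH (boxStableSubmonoid K L fs)) N :=
  saturatedInvariantsAdmitRoots_ofLocalField_box_of_coprime_index K L H hH fs N hcop

end LocalField

end Def22Context

end PadicKummer

end Literature.AlgebraicGeometry.Frobenioids

end
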